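import Summits.QuantumFields.BalabanUV.T4Continuum.Support.NE7FlatGradientModulusPrep
import HarnessLib

/-!
# NE7FlatGradientLetterBlockDiv — THE FLAT C¹ COMPACT LETTER, PART (iii): BLOCK-CONSTANT DIVERGENCE THROUGH THE SECOND-DIFFERENCE KERNEL. For a flat (`U = 1`)
# matrix-valued bond field `Z` supported in a cube of radius `R` with `flatDiv Z = g + s`, `g` ARBITRARY bounded (`‖g‖ ≤ G₀`, vanishing off the cube; in use the
# block constants `χ·(c∘blk_M)`) and `s` Lipschitz (`‖s(x+e_λ) − s(x)‖ ≤ D′`): `‖Z(x+e_μ,κ) − Z(x,κ)‖ ≤ C(d)·(R+1)·(B′ + D′) + C′(d)·(1 + log(R+1))·G₀`,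
# `B′ ≥ sup‖∇(curlAt 1 Z)‖` — the junction logarithm of gen 154's FINDING-1 made explicit and nothing more (INTERFACE REQUEST NE7 stub (S-c) (iii), [NE7P1-G107-INBOX-1] (4))

Cell `pub-balaban`, rung (B)+1 sub-cell t4; written by the row-NE7b OWNER lineage `b2b-balaban-t4-ne7b-p1` (gen 154) for the sibling crux row NE7 (lineage `t4-ne7-p1`,
gen 107's INTERFACE REQUEST NE7→NE7b stub (S-c) PART (iii), `HOME/INBOX.md` [NE7P1-G107-INBOX-1] (4); memo `t4/b2b-balaban-t4-ne7-p1-g107/ROAD-G107.md` §2–§4, AMENDMENT 6: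
«a C¹ slice letter WITH the junction logarithm, `sup‖∇Y‖ ≤ K(B + MB′)(1 + log M) + K″·sup|c|·(1 + log M)` … then yields `‖∇X_T‖ ≲ θ^{42k}(1 + k·log L) ≤ θ^{38k}`»).
Sequel of `NE7FlatGradientLetterCompact` (part (i): `g = 0`) and `NE7FlatGradientModulusPrep` (the logarithmic shell sum).
THE MECHANISM ([folklore] discrete potential theory over pv23's `Beta/PoissonInterior`, KERNEL).  As in part (i), for a real functional `f` the increment
`f(Z(x+e_μ,κ) − Z(x,κ)) = −Σ_{y ∈ cube c (R+2)} K(x−y)·Δ(f∘Z_κ)(y)` with the dipole kernel `K = dG₀ μ` and (`lapVec_eq_curl_div`)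
`Δ Z_κ = Σ_ν[curl(y;ν,κ) − curl(y−e_ν;ν,κ)] + [g(y+e_κ) − g(y)] + [s(y+e_κ) − s(y)]`.  The curl- and `s`-parts are bounded data against the dipole row sum
`Σ|K| = O(R+1)` (`G₀_diff_bound`, `sum_cube_inv_nrm_pow_le`); the `g`-part is SUMMED BY PARTS (`PoissonInterior.sum_shift`: `g` has compact support) onto the second
difference `K(v+e_κ) − K(v)`, `|·| ≤ C₂·nrm(v)^{−d}` (`G₀_diff2_bound`), whose row sum over the cube is `1 + 2d·3^{d−1}(1 + log⁺(2R+3))` (`sum_cube_far_inv_nrm_pow_le`) — ONE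
LOGARITHM OF THE RADIUS, no power.  `NormedSpace.norm_le_dual_bound` returns to the matrix norm.
WHAT ([folklore]; 0 def, 0 sorry; every `d ≥ 3`; constants existential in `d`).  §1 `lapVec_eq_curl_g_s`, `sum_cube_inv_nrm_pow_d_le` (the full-cube logarithmic sum incl. the centre),
`one_add_posLog_le` (`1 + log⁺(2R+3) ≤ 3(1 + log(R+1))`).  §2 **`gradient_letter_cube_blockDiv`**.  §3 **`gradient_letter_box_blockDiv`** (box `M•c′ + [0, MN′)^{d+1}`, `d+1 ≥ 3`,
every `L ≥ 1`: `≤ K·(L^{k+1}N′)·(B′ + D′) + K′·(1 + log(L^{k+1}N′))·G₀`, `g` vanishing off the box).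
HONEST FRAMING (page 1): `U = 1`, linear, flat; a JUNCTION over pv23's potential theory; the logarithm is GENUINE on the slice `𝒯_E(1)` (gen 154 FINDING-1 ∕ t4-ne7-p1 g107 j341908:
the block-constant part of the divergence has junction alternating sums, whose Newtonian potential has `(A∕2π)·log M` mixed second differences at codimension-2 block junctions);
NOT the curved C¹ letter, NOT the supplier of socket `h_w`, NOT NE7, nothing of row NE7b (`T4WeightBudget.RelWeightBound` NOT PRINTED ∕ NOT PROVED); nothing of Bałaban's
asserted; spine count = dagwriter∕referees' call; finite T⁴ rung (B)+1 — NOT infinite volume, NOT mass gap, NOT BetaPertH, NOT Clay.  Continuum YM on T⁴ ⇐ BetaPertH ∧ nine spine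
estimates (0/9 proved); BetaPertH ⇐ (D1) ∧ (D4) ∧ CAP+tail; G-an2-4 gates asym, D1 and NE2/3/4.
-/

set_option autoImplicit false

open scoped BigOperators Matrix.Norms.L2Operator
open Finset

namespace Summit.QuantumFields.BalabanUV.T4Continuum.NE7FlatGradientLetterBlockDiv

open Literature.MathematicalPhysics.QuantumFieldTheory.Balaban1983to89
open B7Prop1Explicit (Site e)
open T4AveragingDeficitWall (curlAt)
open BlockAveragePushDirSplit (flat)
open NE3CoercivityScaling (flatDiv)
open Literature.Probability.LatticeModels (latticeLaplacianZd)
open Beta.PoissonInterior (cube mem_cube cube_mono mem_cube_zero_iff supNorm supNorm_zero nrm nrm_pos G₀ dG₀ G₀_diff_bound G₀_diff2_bound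
  green_rep sum_cube_inv_nrm_pow_le sum_shift shell_zero)
open NE7FlatGradientLetterCompact (lapVec_eq_curl_div curlAt_flat_diag lap_dual_apply mem_cube_succ_of_add_e)
open NE7FlatGradientModulusPrep (sum_reflect_le sum_cube_far_inv_nrm_pow_le)

noncomputable section

variable {d : ℕ} {n : Type*} [Fintype n] [DecidableEq n]

/-! ## §1 The componentwise Laplacian with a split divergence; the full-cube logarithmic sum -/

/-- `ΔZ_κ(y) = Σ_ν[curl(y;ν,κ) − curl(y−e_ν;ν,κ)] + [g(y+e_κ) − g(y)] + [s(y+e_κ) − s(y)]` when `flatDiv Z = g + s`. [folklore] -/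
theorem lapVec_eq_curl_g_s (Z : Site d → Fin d → Matrix n n ℂ) (g s : Site d → Matrix n n ℂ) (hgs : ∀ x, flatDiv Z x = g x + s x)
    (y : Site d) (κ : Fin d) :
    ∑ μ, ((Z (y + e μ) κ - Z y κ) - (Z y κ - Z (y - e μ) κ)) =
      ∑ μ, (curlAt (flat (d := d) (n := n)) Z y μ κ - curlAt (flat (d := d) (n := n)) Z (y - e μ) μ κ)
        + (g (y + e κ) - g y) + (s (y + e κ) - s y) := by
  rw [lapVec_eq_curl_div, hgs, hgs]
  abel

omit [Fintype n] [DecidableEq n] in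
/-- The full-cube logarithmic sum: `Σ_{z ∈ cube 0 R′} nrm(z)^{−d} ≤ 1 + 2d·3^{d−1}·(1 + log⁺ R′)`. [folklore] -/
theorem sum_cube_inv_nrm_pow_d_le (hd : 0 < d) (R' : ℕ) :
    ∑ z ∈ cube (0 : Site d) R', 1 / nrm z ^ d ≤ 1 + 2 * d * 3 ^ (d - 1) * (1 + Real.posLog (R' : ℝ)) := by
  rw [← Finset.sum_filter_add_sum_filter_not (cube (0 : Site d) R') (fun z => 1 ≤ supNorm z)]
  have h1 := sum_cube_far_inv_nrm_pow_le (d := d) hd R' 1 le_rfl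
  rw [Nat.cast_one, div_one] at h1
  have h0 : (cube (0 : Site d) R').filter (fun z => ¬ 1 ≤ supNorm z) = {0} := by
    rw [← shell_zero R']
    exact Finset.filter_congr fun z _ => by omega
  rw [h0, Finset.sum_singleton]
  have : nrm (0 : Site d) = 1 := by unfold nrm; rw [supNorm_zero]; simp
  rw [this, one_pow, div_one]
  linarith

omit [Fintype n] [DecidableEq n] in
/-- `1 + log⁺(2R + 3) ≤ 3·(1 + log(R + 1))`. [folklore] -/
theorem one_add_posLog_le (R : ℕ) : 1 + Real.posLog ((2 * R + 3 : ℕ) : ℝ) ≤ 3 * (1 + Real.log ((R : ℝ) + 1)) := by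
  have hR1 : (1 : ℝ) ≤ (R : ℝ) + 1 := by have : (0 : ℝ) ≤ R := Nat.cast_nonneg R; linarith
  have hlog0 : 0 ≤ Real.log ((R : ℝ) + 1) := Real.log_nonneg hR1
  have hx : (1 : ℝ) ≤ ((2 * R + 3 : ℕ) : ℝ) := by exact_mod_cast (by omega : 1 ≤ 2 * R + 3)
  rw [Real.posLog_eq_log (by rw [abs_of_pos (by positivity)]; exact hx)]
  have h3 : ((2 * R + 3 : ℕ) : ℝ) ≤ 3 * ((R : ℝ) + 1) := by push_cast; linarith
  have hle : Real.log ((2 * R + 3 : ℕ) : ℝ) ≤ Real.log 3 + Real.log ((R : ℝ) + 1) := by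
    rw [← Real.log_mul (by norm_num) (by positivity)]
    exact Real.log_le_log (by positivity) h3
  have hl3 : Real.log (3 : ℝ) ≤ 2 := by
    have := Real.log_le_sub_one_of_pos (show (0 : ℝ) < 3 by norm_num); linarith
  linarith

/-! ## §2 The letter on a cube -/

/-- **THE FLAT C¹ COMPACT LETTER WITH BLOCK-CONSTANT DIVERGENCE, CUBE GEOMETRY** (`d ≥ 3`): `∃ C C′ ≥ 0` (functions of `d`) such that for every cube `cube c R`, every bond
field `Z` vanishing off it, every `B′ ≥ 0` bounding `‖curlAt 1 Z (z + e_λ) μ ν − curlAt 1 Z z μ ν‖` (`μ ≠ ν`), every splitting `flatDiv Z = g + s` with `g` vanishing off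
`cube c (R+1)` (so `s` does too), `‖g x‖ ≤ Gb`, and `‖s (x + e_λ) − s x‖ ≤ D′`:
`‖Z (x + e_μ) κ − Z x κ‖ ≤ C·(R + 1)·(B′ + D′) + C′·(1 + log(R + 1))·Gb`. [folklore] -/
theorem gradient_letter_cube_blockDiv (hd : 3 ≤ d) : ∃ C : ℝ, 0 ≤ C ∧ ∃ C' : ℝ, 0 ≤ C' ∧
    ∀ (c : Site d) (R : ℕ) (Z : Site d → Fin d → Matrix n n ℂ), (∀ x, x ∉ cube c R → Z x = 0) →
      ∀ (B' : ℝ), 0 ≤ B' → (∀ (z : Site d) (lam μ ν : Fin d), μ ≠ ν →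
        ‖curlAt (flat (d := d) (n := n)) Z (z + e lam) μ ν - curlAt (flat (d := d) (n := n)) Z z μ ν‖ ≤ B') →
      ∀ (g s : Site d → Matrix n n ℂ), (∀ x, flatDiv Z x = g x + s x) → (∀ x, x ∉ cube c (R + 1) → g x = 0) →
      ∀ (Gb : ℝ), (∀ x, ‖g x‖ ≤ Gb) → ∀ (D' : ℝ), (∀ (x : Site d) (lam : Fin d), ‖s (x + e lam) - s x‖ ≤ D') →
      ∀ (x : Site d) (μ κ : Fin d),
        ‖Z (x + e μ) κ - Z x κ‖ ≤ C * ((R : ℝ) + 1) * (B' + D') + C' * (1 + Real.log ((R : ℝ) + 1)) * Gb := by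
  obtain ⟨C₁, hC₁, hG⟩ := G₀_diff_bound hd
  obtain ⟨C₂, hC₂, hG2⟩ := G₀_diff2_bound hd
  have hd0 : 0 < d := by omega
  have hd1 : (1 : ℝ) ≤ d := by exact_mod_cast hd0
  have hA0 : (0 : ℝ) ≤ 2 * d * 3 ^ (d - 1) := by positivity
  refine ⟨4 * d * C₁ * (1 + 2 * d * 3 ^ (d - 1)), by positivity, 3 * C₂ * (1 + 2 * d * 3 ^ (d - 1)), by positivity,
    fun c R Z hZ B' hB0 hB g s hgs hg0 Gb hg D' hs x μ κ => ?_⟩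
  have hG00 : 0 ≤ Gb := (norm_nonneg _).trans (hg x)
  have hD0 : 0 ≤ D' := (norm_nonneg _).trans (hs x μ)
  have hR0 : (0 : ℝ) ≤ R := by positivity
  have hlog0 : 0 ≤ Real.log ((R : ℝ) + 1) := Real.log_nonneg (by linarith)
  have hrhs0 : 0 ≤ 4 * d * C₁ * (1 + 2 * d * 3 ^ (d - 1)) * ((R : ℝ) + 1) * (B' + D')
      + 3 * C₂ * (1 + 2 * d * 3 ^ (d - 1)) * (1 + Real.log ((R : ℝ) + 1)) * Gb := by positivity
  by_cases hx : x ∈ cube c (R + 1)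
  swap
  · have h1 : Z x = 0 := hZ x fun h => hx (cube_mono (Nat.le_succ R) h)
    have h2 : Z (x + e μ) = 0 := hZ (x + e μ) fun h => hx (mem_cube_succ_of_add_e h)
    simp only [h1, h2, Pi.zero_apply, sub_self, norm_zero]
    exact hrhs0
  -- the summation box `T = cube c (R+2)` and the two row sums seen from `x`
  set T := cube c (R + 2) with hTdef
  have hxT : ∀ y ∈ T, x - y ∈ cube (0 : Site d) (2 * R + 3) := by
    intro y hy
    rw [mem_cube] at hx hy
    rw [mem_cube_zero_iff, Beta.PoissonInterior.supNorm_le_iff]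
    intro i
    have h1 := hx i
    have h2 := hy i
    rw [Beta.PoissonInterior.natAbs_le_iff_abs_le, Pi.sub_apply]
    calc |x i - y i| = |(x i - c i) - (y i - c i)| := by ring_nf
      _ ≤ |x i - c i| + |y i - c i| := abs_sub _ _
      _ ≤ ((R + 1 : ℕ) : ℤ) + ((R + 2 : ℕ) : ℤ) := add_le_add h1 h2
      _ = ((2 * R + 3 : ℕ) : ℤ) := by push_cast; ring
  have hrow1 : ∑ y ∈ T, 1 / nrm (x - y) ^ (d - 1) ≤ 1 + 2 * d * 3 ^ (d - 1) * ((2 * R + 3 : ℕ) : ℝ) := by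
    refine (sum_reflect_le x T _ (fun z => 1 / nrm z ^ (d - 1)) (fun z => one_div_nonneg.mpr (pow_nonneg (nrm_pos z).le _)) hxT).trans ?_
    have h := sum_cube_inv_nrm_pow_le (d := d) hd0 (2 * R + 3) (d - 1) le_rfl
    rwa [Nat.sub_sub_self (by omega : 1 ≤ d), pow_one] at h
  have hrowd : ∑ y ∈ T, 1 / nrm (x - y) ^ d ≤ 1 + 2 * d * 3 ^ (d - 1) * (1 + Real.posLog ((2 * R + 3 : ℕ) : ℝ)) :=
    (sum_reflect_le x T _ (fun z => 1 / nrm z ^ d) (fun z => one_div_nonneg.mpr (pow_nonneg (nrm_pos z).le _)) hxT).trans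
      (sum_cube_inv_nrm_pow_d_le hd0 _)
  have hRow1_0 : (0 : ℝ) ≤ 1 + 2 * d * 3 ^ (d - 1) * ((2 * R + 3 : ℕ) : ℝ) := by positivity
  have hP0 : 0 ≤ Real.posLog ((2 * R + 3 : ℕ) : ℝ) := Real.posLog_nonneg
  have hRowd_0 : (0 : ℝ) ≤ 1 + 2 * d * 3 ^ (d - 1) * (1 + Real.posLog ((2 * R + 3 : ℕ) : ℝ)) := by positivity
  -- kernel bounds
  have hK1 : ∀ v : Site d, |dG₀ μ v| ≤ C₁ / nrm v ^ (d - 1) := fun v => (hG v μ).1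
  have hK2 : ∀ v : Site d, |dG₀ μ (v + e κ) - dG₀ μ v| ≤ C₂ / nrm v ^ d := by
    intro v
    have h := hG2 v μ κ
    have : dG₀ μ (v + e κ) - dG₀ μ v = G₀ (v + Pi.single κ 1 + Pi.single μ 1) - G₀ (v + Pi.single κ 1) - G₀ (v + Pi.single μ 1) + G₀ v := by
      show G₀ (v + Pi.single κ 1 + Pi.single μ 1) - G₀ (v + Pi.single κ 1) - (G₀ (v + Pi.single μ 1) - G₀ v) = _
      ring
    rw [this]
    exact h
  -- the bound on every real functional
  set Mtot : ℝ := ((d : ℝ) * B' + D') * C₁ * (1 + 2 * d * 3 ^ (d - 1) * ((2 * R + 3 : ℕ) : ℝ))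
      + Gb * C₂ * (1 + 2 * d * 3 ^ (d - 1) * (1 + Real.posLog ((2 * R + 3 : ℕ) : ℝ))) with hMtot
  have hM0 : 0 ≤ Mtot := by positivity
  have key : ‖Z (x + e μ) κ - Z x κ‖ ≤ Mtot := by
    refine NormedSpace.norm_le_dual_bound ℝ _ hM0 fun f => ?_
    have hgf : ∀ y, y ∉ cube c (R + 1) → (fun z => f (Z z κ)) y = 0 := fun y hy => by
      simp only [hZ y (fun h => hy (cube_mono (Nat.le_succ R) h)), Pi.zero_apply, map_zero]
    -- dipole representation over `T = cube c (R+2)`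
    have hrep : f (Z (x + e μ) κ - Z x κ) = -∑ y ∈ T, dG₀ μ (x - y) * latticeLaplacianZd (fun z => f (Z z κ)) y := by
      have e1 : f (Z (x + e μ) κ) = -∑ y ∈ T, G₀ (x + e μ - y) * latticeLaplacianZd (fun z => f (Z z κ)) y :=
        green_rep hd c (R + 1) (fun z => f (Z z κ)) hgf (x + e μ)
      have e2 : f (Z x κ) = -∑ y ∈ T, G₀ (x - y) * latticeLaplacianZd (fun z => f (Z z κ)) y :=
        green_rep hd c (R + 1) (fun z => f (Z z κ)) hgf x
      rw [map_sub, e1, e2, neg_sub_neg, ← Finset.sum_sub_distrib, ← Finset.sum_neg_distrib]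
      refine Finset.sum_congr rfl fun y _ => ?_
      have hy : G₀ (x + e μ - y) = G₀ (x - y + Pi.single μ 1) := by
        rw [show x + e μ - y = x - y + e μ by abel]
        rfl
      rw [hy, dG₀]
      ring
    -- split the scalar Laplacian: curl part + s part (=: q) and the g part
    have hlap : ∀ y, latticeLaplacianZd (fun z => f (Z z κ)) y
        = f (∑ ν, (curlAt (flat (d := d) (n := n)) Z y ν κ - curlAt (flat (d := d) (n := n)) Z (y - e ν) ν κ) + (s (y + e κ) - s y))
          + (f (g (y + e κ)) - f (g y)) := by
      intro y
      rw [lap_dual_apply, lapVec_eq_curl_g_s Z g s hgs]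
      simp only [map_add, map_sub]
      ring
    have hq : ∀ y, ‖f (∑ ν, (curlAt (flat (d := d) (n := n)) Z y ν κ - curlAt (flat (d := d) (n := n)) Z (y - e ν) ν κ) + (s (y + e κ) - s y))‖
        ≤ ‖f‖ * (d * B' + D') := by
      intro y
      refine (f.le_opNorm _).trans (mul_le_mul_of_nonneg_left ?_ (norm_nonneg _))
      refine (norm_add_le _ _).trans (add_le_add ?_ (hs y κ))
      calc ‖∑ ν, (curlAt (flat (d := d) (n := n)) Z y ν κ - curlAt (flat (d := d) (n := n)) Z (y - e ν) ν κ)‖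
          ≤ ∑ _ν : Fin d, B' := (norm_sum_le _ _).trans (Finset.sum_le_sum fun ν _ => ?_)
        _ = d * B' := by simp
      by_cases hν : ν = κ
      · subst hν; rw [curlAt_flat_diag, curlAt_flat_diag, sub_zero, norm_zero]; exact hB0
      · have h := hB (y - e ν) ν ν κ hν; rwa [sub_add_cancel] at h
    -- the g part summed by parts
    have hshift : ∑ y ∈ T, dG₀ μ (x - y) * f (g (y + e κ)) = ∑ y ∈ T, dG₀ μ (x - y + e κ) * f (g y) := by
      have h := sum_shift T (e κ) (fun y => dG₀ μ (x - y + e κ) * f (g y))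
        (fun y hy => by
          have : g y = 0 := hg0 y fun h => hy (cube_mono (by omega) h)
          simp only [this, map_zero, mul_zero])
        (fun y hy => by
          have hgy : g y ≠ 0 := by
            intro h0; apply hy; simp only [h0, map_zero, mul_zero]
          have hyc : y ∈ cube c (R + 1) := by by_contra h'; exact hgy (hg0 y h')
          rw [mem_cube] at hyc ⊢
          intro i
          have h1 := hyc i
          have hs1 : |(e κ : Site d) i| ≤ 1 := by
            change |(Pi.single κ (1 : ℤ) : Site d) i| ≤ 1
            rw [Pi.single_apply]; split_ifs <;> simp
          rw [Pi.sub_apply]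
          calc |y i - (e κ : Site d) i - c i| = |(y i - c i) - (e κ : Site d) i| := by ring_nf
            _ ≤ |y i - c i| + |(e κ : Site d) i| := abs_sub _ _
            _ ≤ ((R + 1 : ℕ) : ℤ) + 1 := add_le_add h1 hs1
            _ = ((R + 2 : ℕ) : ℤ) := by push_cast; ring)
      rw [← h]
      refine Finset.sum_congr rfl fun y _ => ?_
      rw [show x - (y + e κ) + e κ = x - y by abel]
    have hgsum : ∑ y ∈ T, dG₀ μ (x - y) * (f (g (y + e κ)) - f (g y))
        = ∑ y ∈ T, (dG₀ μ (x - y + e κ) - dG₀ μ (x - y)) * f (g y) := by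
      simp only [mul_sub, Finset.sum_sub_distrib, hshift, sub_mul]
    -- assemble
    rw [hrep, norm_neg]
    have hsplit : ∑ y ∈ T, dG₀ μ (x - y) * latticeLaplacianZd (fun z => f (Z z κ)) y
        = ∑ y ∈ T, dG₀ μ (x - y) * f (∑ ν, (curlAt (flat (d := d) (n := n)) Z y ν κ - curlAt (flat (d := d) (n := n)) Z (y - e ν) ν κ) + (s (y + e κ) - s y))
          + ∑ y ∈ T, (dG₀ μ (x - y + e κ) - dG₀ μ (x - y)) * f (g y) := by
      rw [← hgsum, ← Finset.sum_add_distrib]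
      exact Finset.sum_congr rfl fun y _ => by rw [hlap, mul_add]
    rw [hsplit]
    refine (norm_add_le _ _).trans ?_
    have hA : ‖∑ y ∈ T, dG₀ μ (x - y) * f (∑ ν, (curlAt (flat (d := d) (n := n)) Z y ν κ - curlAt (flat (d := d) (n := n)) Z (y - e ν) ν κ) + (s (y + e κ) - s y))‖
        ≤ ((d : ℝ) * B' + D') * C₁ * (1 + 2 * d * 3 ^ (d - 1) * ((2 * R + 3 : ℕ) : ℝ)) * ‖f‖ := by
      calc _ ≤ ∑ y ∈ T, (C₁ * (1 / nrm (x - y) ^ (d - 1))) * (‖f‖ * (d * B' + D')) :=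
            (norm_sum_le _ _).trans (Finset.sum_le_sum fun y _ => by
              rw [norm_mul, Real.norm_eq_abs]
              exact mul_le_mul ((hK1 _).trans (le_of_eq (by ring))) (hq y) (norm_nonneg _)
                (mul_nonneg hC₁ (one_div_nonneg.mpr (pow_nonneg (nrm_pos _).le _))))
        _ = C₁ * (‖f‖ * (d * B' + D')) * ∑ y ∈ T, 1 / nrm (x - y) ^ (d - 1) := by
            rw [Finset.mul_sum]; exact Finset.sum_congr rfl fun y _ => by ring
        _ ≤ C₁ * (‖f‖ * (d * B' + D')) * (1 + 2 * d * 3 ^ (d - 1) * ((2 * R + 3 : ℕ) : ℝ)) :=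
            mul_le_mul_of_nonneg_left hrow1 (by positivity)
        _ = _ := by ring
    have hB : ‖∑ y ∈ T, (dG₀ μ (x - y + e κ) - dG₀ μ (x - y)) * f (g y)‖
        ≤ Gb * C₂ * (1 + 2 * d * 3 ^ (d - 1) * (1 + Real.posLog ((2 * R + 3 : ℕ) : ℝ))) * ‖f‖ := by
      calc _ ≤ ∑ y ∈ T, (C₂ * (1 / nrm (x - y) ^ d)) * (‖f‖ * Gb) :=
            (norm_sum_le _ _).trans (Finset.sum_le_sum fun y _ => by
              rw [norm_mul, Real.norm_eq_abs]
              refine mul_le_mul ((hK2 _).trans (le_of_eq (by ring))) ?_ (norm_nonneg _)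
                (mul_nonneg hC₂ (one_div_nonneg.mpr (pow_nonneg (nrm_pos _).le _)))
              exact (f.le_opNorm _).trans (mul_le_mul_of_nonneg_left (hg y) (norm_nonneg _)))
        _ = C₂ * (‖f‖ * Gb) * ∑ y ∈ T, 1 / nrm (x - y) ^ d := by
            rw [Finset.mul_sum]; exact Finset.sum_congr rfl fun y _ => by ring
        _ ≤ C₂ * (‖f‖ * Gb) * (1 + 2 * d * 3 ^ (d - 1) * (1 + Real.posLog ((2 * R + 3 : ℕ) : ℝ))) :=
            mul_le_mul_of_nonneg_left hrowd (by positivity)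
        _ = _ := by ring
    calc _ ≤ _ := add_le_add hA hB
      _ = Mtot * ‖f‖ := by rw [hMtot]; ring
  -- relax the constants
  have hS' : (d : ℝ) * B' + D' ≤ d * (B' + D') := by nlinarith
  have hRow1' : 1 + 2 * d * 3 ^ (d - 1) * ((2 * R + 3 : ℕ) : ℝ) ≤ (1 + 2 * d * 3 ^ (d - 1)) * (4 * ((R : ℝ) + 1)) := by
    push_cast; nlinarith
  have hRowd' : 1 + 2 * d * 3 ^ (d - 1) * (1 + Real.posLog ((2 * R + 3 : ℕ) : ℝ)) ≤ (1 + 2 * d * 3 ^ (d - 1)) * (3 * (1 + Real.log ((R : ℝ) + 1))) := by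
    have h1 := one_add_posLog_le R
    nlinarith
  calc ‖Z (x + e μ) κ - Z x κ‖ ≤ Mtot := key
    _ ≤ (d * (B' + D')) * C₁ * ((1 + 2 * d * 3 ^ (d - 1)) * (4 * ((R : ℝ) + 1)))
        + Gb * C₂ * ((1 + 2 * d * 3 ^ (d - 1)) * (3 * (1 + Real.log ((R : ℝ) + 1)))) := by
        rw [hMtot]
        apply add_le_add
        · exact mul_le_mul (mul_le_mul_of_nonneg_right hS' hC₁) hRow1' hRow1_0 (by positivity)
        · exact mul_le_mul_of_nonneg_left hRowd' (by positivity)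
    _ = 4 * d * C₁ * (1 + 2 * d * 3 ^ (d - 1)) * ((R : ℝ) + 1) * (B' + D')
        + 3 * C₂ * (1 + 2 * d * 3 ^ (d - 1)) * (1 + Real.log ((R : ℝ) + 1)) * Gb := by ring


/-! ## §3 The same letter in the block-aligned-box geometry -/

/-- **THE FLAT C¹ COMPACT LETTER WITH BLOCK-CONSTANT DIVERGENCE, BOX GEOMETRY** (dimension `d + 1 ≥ 3`, every `L ≥ 1`, every `k`; `M = L^{k+1}`): `∃ K K′ ≥ 0` (functions
of `d`) such that for every block-aligned box `M•c′ + [0, M·N′)^{d+1}` (`N′ ≥ 1`), every bond field `Z` vanishing off the box, every `B′ ≥ 0` bounding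
`‖curlAt 1 Z (z + e_λ) μ ν − curlAt 1 Z z μ ν‖` (`μ ≠ ν`), every splitting `flatDiv Z = g + s` with `g` vanishing off the one-site enlargement of the box
(`M c′_i − 1 ≤ x_i ≤ M c′_i + M N′`), `‖g x‖ ≤ Gb`, `‖s (x + e_λ) − s x‖ ≤ D′`:
`‖Z (x + e_μ) κ − Z x κ‖ ≤ K·(L^{k+1}·N′)·(B′ + D′) + K′·(1 + log(L^{k+1}·N′))·Gb`. [folklore] -/
theorem gradient_letter_box_blockDiv (hd : 2 ≤ d) :
    ∃ K : ℝ, 0 ≤ K ∧ ∃ K' : ℝ, 0 ≤ K' ∧ ∀ (L : ℕ), 1 ≤ L → ∀ (k : ℕ) (c' : Site (d + 1)) (N' : ℕ), 1 ≤ N' →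
      ∀ (Z : Site (d + 1) → Fin (d + 1) → Matrix n n ℂ),
      (∀ x : Site (d + 1), (∃ i, ¬ (((L ^ (k + 1) : ℕ) : ℤ) * c' i ≤ x i ∧
          x i < ((L ^ (k + 1) : ℕ) : ℤ) * c' i + ((L ^ (k + 1) : ℕ) : ℤ) * N')) → Z x = 0) →
      ∀ (B' : ℝ), 0 ≤ B' → (∀ (z : Site (d + 1)) (lam μ ν : Fin (d + 1)), μ ≠ ν →
        ‖curlAt (flat (d := d + 1) (n := n)) Z (z + e lam) μ ν - curlAt (flat (d := d + 1) (n := n)) Z z μ ν‖ ≤ B') →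
      ∀ (g s : Site (d + 1) → Matrix n n ℂ), (∀ x, flatDiv Z x = g x + s x) →
      (∀ x : Site (d + 1), (∃ i, ¬ (((L ^ (k + 1) : ℕ) : ℤ) * c' i - 1 ≤ x i ∧
          x i ≤ ((L ^ (k + 1) : ℕ) : ℤ) * c' i + ((L ^ (k + 1) : ℕ) : ℤ) * N')) → g x = 0) →
      ∀ (Gb : ℝ), (∀ x, ‖g x‖ ≤ Gb) → ∀ (D' : ℝ), (∀ (x : Site (d + 1)) (lam : Fin (d + 1)), ‖s (x + e lam) - s x‖ ≤ D') →
      ∀ (x : Site (d + 1)) (μ κ : Fin (d + 1)),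
        ‖Z (x + e μ) κ - Z x κ‖ ≤ K * ((L : ℝ) ^ (k + 1) * N') * (B' + D') + K' * (1 + Real.log ((L : ℝ) ^ (k + 1) * N')) * Gb := by
  obtain ⟨C, hC, C', hC', h⟩ := gradient_letter_cube_blockDiv (d := d + 1) (n := n) (by omega)
  refine ⟨2 * C, by positivity, 2 * C', by positivity, fun L hL k c' N' hN' Z hZ B' hB0 hB g s hgs hg0 Gb hg D' hs x μ κ => ?_⟩
  have hD0 : 0 ≤ D' := (norm_nonneg _).trans (hs x μ)
  have hG00 : 0 ≤ Gb := (norm_nonneg _).trans (hg x)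
  have hBD : 0 ≤ B' + D' := by positivity
  -- the box lies in the cube of radius `M N′` about its corner; its one-site enlargement in the cube of radius `M N′ + 1`
  have hZ' : ∀ y, y ∉ cube (fun i => ((L ^ (k + 1) : ℕ) : ℤ) * c' i) (L ^ (k + 1) * N') → Z y = 0 := by
    intro y hy
    refine hZ y ?_
    by_contra hall
    simp only [not_exists, not_not] at hall
    apply hy
    rw [mem_cube]
    intro i
    obtain ⟨h1, h2⟩ := hall i
    have hN0 : (0 : ℤ) ≤ ((L ^ (k + 1) : ℕ) : ℤ) * N' := by positivity
    rw [abs_le]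
    constructor <;> push_cast at h1 h2 hN0 ⊢ <;> linarith
  have hg0' : ∀ y, y ∉ cube (fun i => ((L ^ (k + 1) : ℕ) : ℤ) * c' i) (L ^ (k + 1) * N' + 1) → g y = 0 := by
    intro y hy
    refine hg0 y ?_
    by_contra hall
    simp only [not_exists, not_not] at hall
    apply hy
    rw [mem_cube]
    intro i
    obtain ⟨h1, h2⟩ := hall i
    have hN0 : (0 : ℤ) ≤ ((L ^ (k + 1) : ℕ) : ℤ) * N' := by positivity
    rw [abs_le]
    constructor <;> push_cast at h1 h2 hN0 ⊢ <;> linarith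
  have hM1 : 1 ≤ L ^ (k + 1) * N' := Nat.one_le_iff_ne_zero.mpr (Nat.mul_ne_zero (pow_ne_zero _ (by omega)) (by omega))
  have hR1 : (1 : ℝ) ≤ ((L ^ (k + 1) * N' : ℕ) : ℝ) := by exact_mod_cast hM1
  have hRr : ((L ^ (k + 1) * N' : ℕ) : ℝ) = (L : ℝ) ^ (k + 1) * N' := by push_cast; ring
  have hmain := h _ _ Z hZ' B' hB0 hB g s hgs hg0' Gb hg D' hs x μ κ
  -- `log(P + 1) ≤ log 2 + log P ≤ 1 + log P`
  have hlog : Real.log (((L ^ (k + 1) * N' : ℕ) : ℝ) + 1) ≤ 1 + Real.log ((L : ℝ) ^ (k + 1) * N') := by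
    rw [← hRr]
    have h2 : ((L ^ (k + 1) * N' : ℕ) : ℝ) + 1 ≤ 2 * ((L ^ (k + 1) * N' : ℕ) : ℝ) := by linarith
    calc Real.log (((L ^ (k + 1) * N' : ℕ) : ℝ) + 1) ≤ Real.log (2 * ((L ^ (k + 1) * N' : ℕ) : ℝ)) :=
          Real.log_le_log (by positivity) h2
      _ = Real.log 2 + Real.log ((L ^ (k + 1) * N' : ℕ) : ℝ) := Real.log_mul (by norm_num) (by positivity)
      _ ≤ 1 + Real.log ((L ^ (k + 1) * N' : ℕ) : ℝ) := by
          have := Real.log_le_sub_one_of_pos (show (0:ℝ) < 2 by norm_num); linarith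
  have hlogP0 : 0 ≤ Real.log ((L : ℝ) ^ (k + 1) * N') := by rw [← hRr]; exact Real.log_nonneg hR1
  calc ‖Z (x + e μ) κ - Z x κ‖
      ≤ C * (((L ^ (k + 1) * N' : ℕ) : ℝ) + 1) * (B' + D') + C' * (1 + Real.log (((L ^ (k + 1) * N' : ℕ) : ℝ) + 1)) * Gb := hmain
    _ ≤ C * (2 * ((L : ℝ) ^ (k + 1) * N')) * (B' + D') + C' * (2 * (1 + Real.log ((L : ℝ) ^ (k + 1) * N'))) * Gb := by
        apply add_le_add
        · apply mul_le_mul_of_nonneg_right _ hBD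
          apply mul_le_mul_of_nonneg_left _ hC
          rw [← hRr]; linarith
        · apply mul_le_mul_of_nonneg_right _ hG00
          apply mul_le_mul_of_nonneg_left _ hC'
          linarith
    _ = 2 * C * ((L : ℝ) ^ (k + 1) * N') * (B' + D') + 2 * C' * (1 + Real.log ((L : ℝ) ^ (k + 1) * N')) * Gb := by ring

end

end Summit.QuantumFields.BalabanUV.T4Continuum.NE7FlatGradientLetterBlockDiv
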